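import Summits.ResolutionOfSingularities.ResolutionOfSingularities.Theorems.MarkedTransferCampaignW46ThreefoldsGammaFreeGlobal
import Summits.ResolutionOfSingularities.ResolutionOfSingularities.Theorems.MarkedTransferCampaignW46ThreefoldsStepExistsGeneral
import HarnessLib

/-!
# [OURS · L1 W4.6 rung (ii)] SOURCE 2 FOR THE REPAIRED STATEMENT: the typed procedure's rung-(ii) chain yields
# `GammaFreeGlobalOrderReductionDimLeThree p` (proofs; transport of res-L1-s46-pv-3's exhaustion chain to the
# localisation-free predicate `IsPermissibleBlowupSeq`)

Cell res-hironaka, LADDER-RESOLUTION rung L (D-0089), slot W4.6, rung (ii). DRAFT prepared by res-L1-type-o1 for a PROVER to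
file (`--kind proof --supports stmt-ResolutionOfSingularities-16156 --as helper`); it is a verbatim transport of
`…ThreefoldsResolved.lean` l.77–190 / `…ThreefoldsStepExistsGeneral.lean` l.205–227 / `…ThreefoldsGammaFree.lean` l.137–163
(res-L1-s46-pv-3, gen 2) with `Hironaka2017.IsPermissibleLSB` replaced by `CampaignW46.IsPermissibleBlowupSeq` — possible
because that chain never uses the `restrict` constructor. Result: `gammaFreeGlobal_of_shapes_of_cover` /
`gammaFreeGlobal_of_terminates_of_cover` — for the NAMED notion instance `N`, the five σ-shapes (resp. `TerminatesNablaII`)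
and résumé coverage of the standard unresolved regime-(ii) states give the NON-VACUOUS global Γ-free order reduction of
every input of stmt-16156. All hypotheses concern the résumés of `N`; step existence is the kernel fact `nablaStepExists`;
16156 is neither used nor derived; nothing of H. Hironaka's manuscript is asserted. AI-written; AI review is weaker than
expert review. [Hironaka2017] — scope only.
-/

noncomputable section

set_option linter.dupNamespace false -- mandated namespace of this single-conjunct summit

open CategoryTheory AlgebraicGeometry TopologicalSpace

namespace Summit.ResolutionOfSingularities.ResolutionOfSingularities.Theorems

namespace CampaignW46

open Literature.AlgebraicGeometry.Resolution
open Scheme.IdealSheafData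
open Literature.AlgebraicGeometry.Hironaka2017
open Literature.AlgebraicGeometry.Hironaka2017.S02Preliminaries
open Literature.AlgebraicGeometry.Hironaka2017.Datum
open Literature.AlgebraicGeometry.Hironaka2017.S15ARSchemes
open Literature.AlgebraicGeometry.Hironaka2017.S16Proof

universe u

variable {n : ℕ} {p : ℕ} [Fact p.Prime] {K : Type u} [Field K] [CharP K p]

section OneStep

variable {N : Notions.{u} n} {A A' : AmbientDatum p K} {E : IdealExponent A.Z} {R : Resume N A E}

/-- A step of the typed procedure — the blow-up of the WHOLE ambient scheme `Z` along the regular centre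
`D ⊆ ∇(E) ⊆ Sing(E)` — is a sequence of permissible blowing-ups of length one (`IsPermissibleBlowupSeq.single`), with last
transform the ideal of `E′`; it never localises. [folklore] -/
theorem Step.isPermissibleBlowupSeq (s : Step R A') : IsPermissibleBlowupSeq E.J E.b s.π s.E'.J :=
  IsPermissibleBlowupSeq.single s.D s.π s.centre.isRegular_subscheme (fun _ hy => s.le_idealOrder_of_mem hy) s.blowup

end OneStep

section Exhaustion

variable {N : Notions.{u} n} {Rd : Reading p K N} {Rg : Regime p K}

/-- **EXHAUSTION, GLOBAL FORM.** `TerminatesNabla N Rd Rg` and `Progress N Rd Rg` imply that every state `(A, E)` in `Rg`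
with a résumé read by `Rd` is resolved by a SEQUENCE OF PERMISSIBLE BLOWING-UPS: `∃ σ J′, IsPermissibleBlowupSeq E.J E.b σ J′
∧ Sing(J′, b) = ∅` (Noetherian induction `TerminatesNabla.induct`; one step `Step.isPermissibleBlowupSeq`; composition
`IsPermissibleBlowupSeq.comp`) — res-L1-s46-pv-3's `exists_isPermissibleLSB_sing_eq_empty` with the localisation-free
predicate. [folklore] -/
theorem exists_isPermissibleBlowupSeq_sing_eq_empty (hT : TerminatesNabla N Rd Rg) (hP : Progress N Rd Rg)
    {A : AmbientDatum p K} {E : IdealExponent A.Z} (R : Resume N A E) (hRg : Rg A E) (hRd : Rd A E R) :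
    ∃ (Z' : Scheme.{u}) (σ : Z' ⟶ A.Z) (J' : Z'.IdealSheafData),
      IsPermissibleBlowupSeq E.J E.b σ J' ∧ (⟨J', E.b⟩ : IdealExponent Z').sing = ∅ := by
  refine TerminatesNabla.induct hT (fun A E _ => ∃ (Z' : Scheme.{u}) (σ : Z' ⟶ A.Z) (J' : Z'.IdealSheafData),
      IsPermissibleBlowupSeq E.J E.b σ J' ∧ (⟨J', E.b⟩ : IdealExponent Z').sing = ∅) ?_ R hRg hRd
  intro A E R hRg hRd ih
  obtain ⟨A', s, hRg', halt⟩ := hP A E R hRg hRd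
  have h1 : IsPermissibleBlowupSeq E.J E.b s.toStep.π s.toStep.E'.J := s.toStep.isPermissibleBlowupSeq
  rcases halt with hres | ⟨R', hRd'⟩
  · exact ⟨A'.Z, s.toStep.π, s.toStep.E'.J, h1, hres⟩
  · obtain ⟨Z'', τ, J'', h2, hres⟩ := ih A' s R' hRg' hRd'
    exact ⟨Z'', τ ≫ s.toStep.π, J'', h1.comp h2, hres⟩

end Exhaustion

section RungII

variable {N : Notions.{u} n} {Rd : Reading p K N}

/-- **RUNG (ii), EXHAUSTION, GLOBAL FORM.** `TerminatesNablaII N Rd`, step existence in regime (ii) and résumé coverage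
of the standard unresolved regime-(ii) states imply that every standard threefold-hypersurface state is resolved by a
sequence of permissible blowing-ups (resolved states: the empty sequence). [folklore] -/
theorem exists_isPermissibleBlowupSeq_of_regimeII (hT : TerminatesNablaII N Rd) (hS : NablaStepExistsII N Rd)
    (hC : ResumesCover N Rd fun A E => regimeII A E ∧ E.IsStandard ∧ E.sing.Nonempty)
    {A : AmbientDatum p K} {E : IdealExponent A.Z} (hRg : regimeII A E) (hE : E.IsStandard) :
    ∃ (Z' : Scheme.{u}) (σ : Z' ⟶ A.Z) (J' : Z'.IdealSheafData),
      IsPermissibleBlowupSeq E.J E.b σ J' ∧ (⟨J', E.b⟩ : IdealExponent Z').sing = ∅ := by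
  by_cases hres : E.sing = ∅
  · exact ⟨A.Z, 𝟙 A.Z, E.J, IsPermissibleBlowupSeq.nil, hres⟩
  · obtain ⟨R, hRd⟩ := hC A E ⟨hRg, hE, Set.nonempty_iff_ne_empty.mpr hres⟩
    have hT' : TerminatesNabla N Rd (Regime.inter regimeII fun _ E => E.IsStandard) :=
      terminatesNabla_antitone (fun _ _ h => h.1) hT
    exact exists_isPermissibleBlowupSeq_sing_eq_empty hT' (progress_regimeII hS hC) R ⟨hRg, hE⟩ hRd

end RungII

section Host

variable {k : Type u} [Field k] [CharP k p] {N : Notions.{u} n} {Rd : Reading p k N}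

/-- **Γ-FREE GLOBAL ORDER REDUCTION OF EVERY INPUT OF stmt-16156 FOR THE TYPED PROCEDURE.** For the NAMED `N`, `Rd`: if
`TerminatesNablaII N Rd`, `NablaStepExistsII N Rd` and résumé coverage hold, then every input `(k, X, I ≠ 0, m ≥ 1)` of the
host item admits a sequence of permissible blowing-ups `σ : Z′ → X` for `(I, m)` with `ord_x J′ < m` at every point of
`Z′`. 16156 is neither used nor derived. [folklore] -/
theorem exists_isPermissibleBlowupSeq_hostState [PerfectField k] (hT : TerminatesNablaII N Rd)
    (hS : NablaStepExistsII N Rd) (hC : ResumesCover N Rd fun A E => regimeII A E ∧ E.IsStandard ∧ E.sing.Nonempty)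
    (X : Scheme.{u}) (s : X ⟶ Spec (.of k)) [LocallyOfFiniteType s] [QuasiCompact s] [IsIntegral X]
    (hreg : Scheme.IsRegular X) (hdim : topologicalKrullDim X ≤ 3) (I : X.IdealSheafData) (hI : I ≠ ⊥)
    (hIc : IsEffectiveCartier I) (m : ℕ) (hm : 1 ≤ m) :
    ∃ (Z' : Scheme.{u}) (σ : Z' ⟶ X) (J' : Z'.IdealSheafData),
      IsPermissibleBlowupSeq I m σ J' ∧ ∀ x : Z', idealOrder J' x < m := by
  obtain ⟨Z', σ, J', hσ, hres⟩ := exists_isPermissibleBlowupSeq_of_regimeII hT hS hC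
    (regimeII_hostState (p := p) X s hreg hdim I hIc m) (isStandard_hostState X I hI m hm)
  refine ⟨Z', σ, J', hσ, fun x => ?_⟩
  have hx : x ∉ (⟨J', m⟩ : IdealExponent Z').sing := by
    rw [hres]
    exact Set.notMem_empty x
  exact not_le.mp hx

/-- **SOURCE 2 (RUNG (ii)) FOR THE REPAIRED STATEMENT: `GammaFreeGlobalOrderReductionDimLeThree p` from the five shapes and
résumé coverage**, for the NAMED notion instance `N` (transport of res-L1-s46-pv-3's `gammaFree_of_shapes_of_cover`; step
existence is the kernel fact `nablaStepExists`). All hypotheses concern the résumés of `N`; nothing of the manuscript is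
asserted. [folklore] -/
theorem gammaFreeGlobal_of_shapes_of_cover (N : Notions.{u} n)
    (hyp : ∀ (k : Type u) [Field k] [CharP k p] [PerfectField k],
      ∃ (Rd : Reading p k N) (σ : StringReading p k N),
        σ.DecreaseShape Rd regimeII ∧ σ.PrefixShape Rd regimeII ∧ σ.StopsShape Rd regimeII ∧
          σ.TopSingShape Rd regimeII ∧ σ.MonotoneSingShape Rd regimeII ∧
          ResumesCover N Rd (fun A E => regimeII A E ∧ E.IsStandard ∧ E.sing.Nonempty)) :
    GammaFreeGlobalOrderReductionDimLeThree.{u} p := by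
  intro _ k _ _ _ X s _ hloft hqc hint hreg hdim I hI hIc m hm
  obtain ⟨Rd, σ, hD, hP, hM, hT, hL, hC⟩ := hyp k
  haveI := hloft
  haveI := hqc
  haveI := hint
  exact exists_isPermissibleBlowupSeq_hostState (terminatesNablaII_of_shapes_sing N Rd σ hD hP hM hT hL)
    (nablaStepExists N Rd regimeII) hC X s hreg hdim I hI hIc m hm

/-- The same with termination taken as the registered shape: `TerminatesNablaII N Rd` and résumé coverage for every perfect
`k` of characteristic `p` give `GammaFreeGlobalOrderReductionDimLeThree p`. [folklore] -/
theorem gammaFreeGlobal_of_terminates_of_cover (N : Notions.{u} n)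
    (hyp : ∀ (k : Type u) [Field k] [CharP k p] [PerfectField k],
      ∃ Rd : Reading p k N, TerminatesNablaII N Rd ∧
        ResumesCover N Rd (fun A E => regimeII A E ∧ E.IsStandard ∧ E.sing.Nonempty)) :
    GammaFreeGlobalOrderReductionDimLeThree.{u} p := by
  intro _ k _ _ _ X s _ hloft hqc hint hreg hdim I hI hIc m hm
  obtain ⟨Rd, hT, hC⟩ := hyp k
  haveI := hloft
  haveI := hqc
  haveI := hint
  exact exists_isPermissibleBlowupSeq_hostState hT (nablaStepExists N Rd regimeII) hC X s hreg hdim I hI hIc m hm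

end Host

end CampaignW46

end Summit.ResolutionOfSingularities.ResolutionOfSingularities.Theorems

end
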